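import Literature.NumberTheory.Sieve.LinearEquationsInPrimesCrudeBounds
import Literature.NumberTheory.Sieve.LinearEquationsInPrimesProofs
import Mathlib.NumberTheory.Bertrand
import Mathlib.NumberTheory.Primorial
import Mathlib.Analysis.MeanInequalitiesPow
import Mathlib.Analysis.SpecialFunctions.Pow.Real
import Mathlib.Analysis.Complex.ExponentialBounds
import HarnessLib

/-!
# Linear equations in primes: pseudorandom measures and the reduction of §7 (Green–Tao 2010, §§6–7)

Trunk T-SIEVE (`Literature/NumberTheory/Sieve`). Third layer of the decomposition of
`Literature.NumberTheory.Sieve.GreenTaoZiegler2012_finiteComplexity` (see `LinearEquationsInPrimesTransference.lean`,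
`LinearEquationsInPrimesNormalForm.lean`). B. Green, T. Tao, *Linear equations in primes*,
Ann. of Math. 171 (2010), §7 ("Proof of Main Theorem assuming Theorem 7.2") deduces Thm. 5.2
(the level-`s` `W`-tricked product statement `Literature.GreenTao2010_wTrickedProductAt s`) from the
Gowers uniformity estimate Thm. 7.2 (`Literature.GreenTao2010_gowersUniformityAt s`) using two
propositions proved in the appendices:

* **Prop. 6.4** (domination of `1 + Λ'_{b₁,W} + ⋯ + Λ'_{b_t,W}` on `[N^{3/5}, N]` by a
  `D`-pseudorandom measure on `ℤ_{N'}`, `N' ∈ [CN, 2CN]`; App. D, the Goldston–Yıldırım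
  correlation estimates) — vendored here as the named fact
  `Literature.NumberTheory.Sieve.GreenTao2010_pseudorandomDomination`;
* **Prop. 7.1** (the generalised von Neumann theorem: multilinear averages of functions
  dominated by a `D`-pseudorandom measure along a system in `s`-normal form over a convex body
  are controlled by the `U^{s+1}[N]` norm; App. C, Cauchy–Schwarz) — vendored as
  `Literature.NumberTheory.Sieve.GreenTao2010_generalisedVonNeumann`;

together with the vocabulary of §6 that Mathlib lacks (searched `pseudorandom`,
`linear forms condition`, `Gowers`: no hits): measures on `ℤ_{N'}` and the linear forms and
correlation conditions, Defs. 6.1–6.3 (`Literature.NumberTheory.Sieve.linearFormsAverage`, `Literature.NumberTheory.Sieve.LinearFormsCondition`,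
`Literature.NumberTheory.Sieve.CorrelationCondition`, `Literature.NumberTheory.Sieve.IsPseudorandomMeasure`).

Main result (proved): `Literature.NumberTheory.Sieve.GreenTao2010_wTrickedProduct_of_gowersUniformity_of_props` — the
two propositions imply the §7 reduction `Literature.NumberTheory.Sieve.GreenTao2010_wTrickedProduct_of_gowersUniformity`
(Thm. 7.2 at level `s` ⇒ Thm. 5.2 at level `s`), following the printed proof: enlarge the scale
so that `Ψ(K) ⊆ [N]^t`, take `D, C₁` from Prop. 7.1 and `C₀(D)` from Prop. 6.4,
`C = max(C₁, C₀)`, a prime `N' ∈ [CN, 2CN]` (Bertrand's postulate, Mathlib), the measure `ν` of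
Prop. 6.4, and the functions `fᵢ = c (Λ'_{bᵢ,W} - 1)`, which are dominated by `ν`; apply
Thm. 7.2 and Prop. 7.1 and divide out `c^t`. Consequently
(`Literature.NumberTheory.Sieve.GreenTao2010_transference_of_props`) the transference `GreenTao2010_transference` rests
on the printed reductions of §4 and §5 (discharged in `…MainReduction.lean`, `…WTrick.lean`)
and on Props. 6.4 and 7.1 only.

## Rendering the asymptotic notions quantitatively

Defs. 6.1–6.3 are asymptotic ("`1 + o(1)`", "`≪_{m,q} 1`"): a pseudorandom measure is really a
family `ν = ν_N`, and the `o(1)` of Prop. 7.1 depends on the decay rates in (6.2). We make the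
error terms explicit: `LinearFormsCondition m₀ d₀ L₀ η ν` asks `|𝔼 ∏ ν(ψᵢ) - 1| ≤ η` for all
admissible systems, and `CorrelationCondition m₀ A ν` asks (6.3) with moment bounds
`𝔼 τ_m^q ≤ A m q`. Prop. 6.4 then produces, for every `η > 0` and all large `N`, a measure that
is `D`-pseudorandom with error `η` (and moment constants `A` independent of `N`), and Prop. 7.1
holds with a threshold `N₀` and an error `η` depending on `δ` (this is exactly the content of
"`o_δ(N^d) + κ(δ)N^d`" for families: every `o(1)` in App. C comes from finitely many
applications of (6.2) and from the geometry of App. A). As in the sibling files, the cutoff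
`w` of the `W`-trick is rendered range-uniformly (`w₀ ≤ w ≤ ½ log log N`, §5), `o(1)`-rates may
depend on the bounded parameter `C` ("`C₁ ≤ C ≤ O_{s,t,d,L}(1)`", "`o_{δ,C}`, `κ_C`"), and all
constants may depend on `s, t, d, L` (§3).

One point the printed proof leaves implicit is made explicit in the assembly: Prop. 6.4
dominates `Λ'_{bᵢ,W}` only on `[N^{3/5}, N]`, while Prop. 7.1 wants `|fᵢ| ≤ ν` on all of `[N]`;
we therefore take `fᵢ = c (Λ'_{bᵢ,W} - 1) 1_{[N^{3/5}, N]}` (which does not change the sum over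
`K`, on which `ψᵢ > N^{7/10}`) and bound the effect of the cut on the Gowers norm directly from
the definition (B.11) (`Literature.NumberTheory.Sieve.norm_uniformityAvg_sub_le`: changing a `B`-bounded function on
`[1, m]` moves the Gowers average by `O_k(B^{2^k} m / N)`).

## References

* B. Green, T. Tao, *Linear equations in primes*, Ann. of Math. (2) 171 (2010), 1753–1850
  (arXiv:math/0606088): §3 (conventions), §5 (`w`, `W`, `Λ'_{b,W}`), Defs. 6.1, 6.2, 6.3 and the
  definition of `D`-pseudorandom following Def. 6.3, Prop. 6.4, Prop. 7.1, Thm. 7.2, "Proof of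
  Main Theorem assuming Theorem 7.2" (§7), App. B ((B.11)), App. C, App. D; and §9, proof
  of Prop. 9.1 ("the pseudorandom measure `ν` set equal to the constant function `1`, which is
  obviously `D`-pseudorandom for all `D`").
* B. Green, T. Tao, *The primes contain arbitrarily long arithmetic progressions*, Ann. of
  Math. (2) 167 (2008), 481–547, §3 (linear forms and correlation conditions), for comparison.
-/

noncomputable section

open Filter Finset
open scoped Topology

namespace Literature.NumberTheory.Sieve

variable {d t : ℕ}

/-! ### Measures on `ℤ_{N'}` and the pseudorandomness conditions (Defs. 6.1–6.3) -/

/-- The linear forms average `𝔼_{n ∈ ℤ_M^d} ∏_{i ∈ [t]} ν(ψᵢ(n))` of (6.2), the affine-linear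
forms `ψᵢ : ℤ^d → ℤ` being induced on `ℤ_M^d → ℤ_M` "in the obvious manner"
(`AffLinForm.modEval`). [cite: GreenTao2010, Def. 6.2 (6.2)] -/
def linearFormsAverage {M : ℕ} [NeZero M] (ν : ZMod M → ℝ) (Ψ : Fin t → AffLinForm d) : ℝ :=
  (∑ n : Fin d → ZMod M, ∏ i, ν ((Ψ i).modEval M n)) / (M : ℝ) ^ d

/-- **The `(m₀, d₀, L₀)`-linear forms condition with error `η`** (Green–Tao 2010, Def. 6.2, as
printed: "`ν` satisfies the `(m₀,d₀,L₀)`-linear forms condition if the following holds: given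
`1 ≤ d ≤ d₀`, `1 ≤ t ≤ m₀`, and any finite complexity system `Ψ = (ψ₁, …, ψ_t)` of
affine-linear forms on `ℤ^d` with all coefficients of `Ψ̇` bounded in magnitude by `L₀`, we have
`𝔼_{n ∈ ℤ_{N'}^d} ∏_{i ∈ [t]} ν(ψᵢ(n)) = 1 + o_{m₀,d₀,L₀}(1)`", "the error term in (6.2) is
uniform over all choices of constant term `Ψ(0)`"), with the `o(1)` made an explicit `η`
(module docstring). Systems carry the standing hypotheses of Def. 1.1
(`IsNondegenerateSystem`). [cite: GreenTao2010, Def. 6.2] -/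
def LinearFormsCondition {M : ℕ} [NeZero M] (m₀ d₀ L₀ : ℕ) (η : ℝ) (ν : ZMod M → ℝ) : Prop :=
  ∀ (d t : ℕ), 1 ≤ d → d ≤ d₀ → 1 ≤ t → t ≤ m₀ →
    ∀ Ψ : Fin t → AffLinForm d, IsNondegenerateSystem Ψ → IsFiniteComplexitySystem Ψ →
      (∀ i j, |(Ψ i).coeff j| ≤ (L₀ : ℤ)) → |linearFormsAverage ν Ψ - 1| ≤ η

/-- **The `m₀`-correlation condition with moment constants `A`** (Green–Tao 2010, Def. 6.3, as
printed: "`ν` satisfies the `m₀`-correlation condition if for every `1 < m ≤ m₀` there exists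
a weight function `τ = τ_m : ℤ_{N'} → ℝ⁺` which obeys the moment conditions
`𝔼_{n ∈ ℤ_{N'}} τ^q(n) ≪_{m,q} 1` for all `1 ≤ q < ∞` and such that
`𝔼_{n ∈ ℤ_{N'}} ∏_{i ∈ [m]} ν(n + hᵢ) ≤ ∑_{1 ≤ i < j ≤ m} τ(hᵢ - hⱼ)` for all
`h₁, …, h_m ∈ ℤ_{N'}`"), with the implied constants made an explicit `A m q`.
[cite: GreenTao2010, Def. 6.3] -/
def CorrelationCondition {M : ℕ} [NeZero M] (m₀ : ℕ) (A : ℕ → ℝ → ℝ) (ν : ZMod M → ℝ) :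
    Prop :=
  ∀ m : ℕ, 1 < m → m ≤ m₀ → ∃ τ : ZMod M → ℝ, (∀ x, 0 ≤ τ x) ∧
    (∀ q : ℝ, 1 ≤ q → (∑ n : ZMod M, τ n ^ q) / (M : ℝ) ≤ A m q) ∧
    ∀ h : Fin m → ZMod M,
      (∑ n : ZMod M, ∏ i, ν (n + h i)) / (M : ℝ) ≤
        ∑ i : Fin m, ∑ j : Fin m, if i < j then τ (h i - h j) else 0

/-- **`D`-pseudorandom measures** (Green–Tao 2010, Def. 6.1: "a measure on `ℤ_{N'}` is a
function `ν : ℤ_{N'} → ℝ⁺` with `𝔼 ν = 1 + o(1)`" — the latter is the case `d = t = 1`,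
`ψ(n) = n` of (6.2), Remark after Def. 6.2 — and the definition after Def. 6.3: "We call a
measure `D`-pseudorandom if it obeys the `(D,D,D)`-linear forms and `D`-correlation
conditions."), with explicit error `η` and moment constants `A` (module docstring).
[cite: GreenTao2010, Defs. 6.1–6.3] -/
def IsPseudorandomMeasure {M : ℕ} [NeZero M] (D : ℕ) (η : ℝ) (A : ℕ → ℝ → ℝ)
    (ν : ZMod M → ℝ) : Prop :=
  (∀ x, 0 ≤ ν x) ∧ LinearFormsCondition D D D η ν ∧ CorrelationCondition D A ν

/-- The linear forms average of the constant measure `1` is `1`. [folklore] -/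
theorem linearFormsAverage_one {M : ℕ} [NeZero M] (Ψ : Fin t → AffLinForm d) :
    linearFormsAverage (fun _ : ZMod M => (1 : ℝ)) Ψ = 1 := by
  have hM : (M : ℝ) ≠ 0 := by exact_mod_cast NeZero.ne M
  simp only [linearFormsAverage, Finset.prod_const_one, Finset.sum_const, Finset.card_univ,
    card_zmod_pow, nsmul_eq_mul, mul_one, Nat.cast_pow]
  exact div_self (pow_ne_zero _ hM)

/-- The linear forms condition is monotone in its parameters. [folklore] -/
theorem LinearFormsCondition.mono {M : ℕ} [NeZero M] {m₀ d₀ L₀ m₀' d₀' L₀' : ℕ} {η η' : ℝ}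
    {ν : ZMod M → ℝ} (h : LinearFormsCondition m₀ d₀ L₀ η ν) (hm : m₀' ≤ m₀) (hd : d₀' ≤ d₀)
    (hL : L₀' ≤ L₀) (hη : η ≤ η') : LinearFormsCondition m₀' d₀' L₀' η' ν :=
  fun d t hd1 hdd ht1 htm Ψ hΨ hfc hco =>
    (h d t hd1 (hdd.trans hd) ht1 (htm.trans hm) Ψ hΨ hfc fun i j =>
      (hco i j).trans (by exact_mod_cast hL)).trans hη

/-- The correlation condition is monotone in `m₀`. [folklore] -/
theorem CorrelationCondition.mono {M : ℕ} [NeZero M] {m₀ m₀' : ℕ} {A : ℕ → ℝ → ℝ}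
    {ν : ZMod M → ℝ} (h : CorrelationCondition m₀ A ν) (hm : m₀' ≤ m₀) :
    CorrelationCondition m₀' A ν :=
  fun m hm1 hmm => h m hm1 (hmm.trans hm)

/-- `D`-pseudorandomness is monotone in `D` and in the error. [folklore] -/
theorem IsPseudorandomMeasure.mono {M : ℕ} [NeZero M] {D D' : ℕ} {η η' : ℝ} {A : ℕ → ℝ → ℝ}
    {ν : ZMod M → ℝ} (h : IsPseudorandomMeasure D η A ν) (hD : D' ≤ D) (hη : η ≤ η') :
    IsPseudorandomMeasure D' η' A ν :=
  ⟨h.1, h.2.1.mono hD hD hD hη, h.2.2.mono hD⟩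

/-- "The constant function `1`, which is obviously `D`-pseudorandom for all `D`" (with error `0`
and all moment constants `1`, taking `τ_m = 1`). [cite: GreenTao2010, §9 (proof of Prop. 9.1:
"with the pseudorandom measure `ν` set equal to the constant function `1`, which is obviously
`D`-pseudorandom for all `D`")] -/
theorem isPseudorandomMeasure_one {M : ℕ} [NeZero M] (D : ℕ) {η : ℝ} (hη : 0 ≤ η) :
    IsPseudorandomMeasure D η (fun _ _ => 1) (fun _ : ZMod M => (1 : ℝ)) := by
  have hM : (M : ℝ) ≠ 0 := by exact_mod_cast NeZero.ne M
  refine ⟨fun _ => zero_le_one, ?_, ?_⟩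
  · intro d t _ _ _ _ Ψ _ _ _
    rw [linearFormsAverage_one, sub_self, abs_zero]
    exact hη
  · intro m hm1 _
    refine ⟨fun _ => 1, fun _ => zero_le_one, fun q _ => ?_, fun h => ?_⟩
    · simp only [Real.one_rpow, Finset.sum_const, Finset.card_univ, ZMod.card, nsmul_eq_mul,
        mul_one]
      rw [div_self hM]
    · simp only [Finset.prod_const_one, Finset.sum_const, Finset.card_univ, ZMod.card,
        nsmul_eq_mul, mul_one]
      rw [div_self hM]
      -- the pair `(0, 1)` contributes `1`
      have h0 : (0 : ℕ) < m := by omega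
      have h1 : (1 : ℕ) < m := hm1
      calc (1 : ℝ) = if (⟨0, h0⟩ : Fin m) < ⟨1, h1⟩ then (1 : ℝ) else 0 := by
            rw [if_pos (Fin.mk_lt_mk.mpr Nat.zero_lt_one)]
        _ ≤ ∑ j : Fin m, if (⟨0, h0⟩ : Fin m) < j then (1 : ℝ) else 0 :=
            Finset.single_le_sum (f := fun j => if (⟨0, h0⟩ : Fin m) < j then (1 : ℝ) else 0)
              (fun j _ => by positivity) (Finset.mem_univ _)
        _ ≤ ∑ i : Fin m, ∑ j : Fin m, if i < j then (1 : ℝ) else 0 :=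
            Finset.single_le_sum (f := fun i => ∑ j : Fin m, if i < j then (1 : ℝ) else 0)
              (fun i _ => Finset.sum_nonneg fun j _ => by positivity) (Finset.mem_univ _)

/-! ### Named facts: Prop. 6.4 (App. D) and Prop. 7.1 (App. C) -/

/-- **Domination by a pseudorandom measure** (Green–Tao 2010, Prop. 6.4, as printed: "Let
`D > 1` be arbitrary. Then there is a constant `C₀ := C₀(D)` such that the following is true.
Let `C ≥ C₀`, and suppose that `N' ∈ [CN, 2CN]` [a prime, Def. 6.1]. Let
`b₁, …, b_t ∈ {0, 1, …, W - 1}` be coprime to `W := ∏_{p ≤ w} p`. Then there exists a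
`D`-pseudorandom measure `ν : ℤ_{N'} → ℝ⁺` which obeys the pointwise bounds
`1 + Λ'_{b₁,W}(n) + ⋯ + Λ'_{b_t,W}(n) ≪_{D,C} ν(n)` for all `n ∈ [N^{3/5}, N]`, where we
identify `n` with an element of `ℤ_{N'}` in the obvious manner."; proof in App. D). Rendered
with the quantitative pseudorandomness of this file (for every error `η > 0`, for `N` large and
the cutoff `w` in the admissible range of §5, with moment constants `A` and domination constant
`M` independent of `N`, `w`, `b`; all constants may also depend on `t`, §3), and with residues
`bᵢ ∈ [W]` coprime to `W` as in Thms. 5.1–7.2 (the same residue classes).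
[cite: GreenTao2010, Prop. 6.4 and App. D] -/
def GreenTao2010_pseudorandomDomination : Prop :=
  ∀ (D t : ℕ), 2 ≤ D → 1 ≤ t → ∃ C₀ : ℝ, 0 < C₀ ∧ ∀ C : ℝ, C₀ ≤ C →
    ∃ M : ℝ, 0 < M ∧ ∃ A : ℕ → ℝ → ℝ, ∀ η : ℝ, 0 < η → ∃ w₀ N₀ : ℕ, ∀ N : ℕ, N₀ ≤ N →
      ∀ w : ℕ, w₀ ≤ w → (w : ℝ) ≤ Real.log (Real.log N) / 2 →
        ∀ (N' : ℕ) [NeZero N'], N'.Prime → C * N ≤ (N' : ℝ) → (N' : ℝ) ≤ 2 * C * N →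
          ∀ b : Fin t → ℕ,
            (∀ i, 1 ≤ b i ∧ b i ≤ primorial w ∧ Nat.Coprime (b i) (primorial w)) →
            ∃ ν : ZMod N' → ℝ, IsPseudorandomMeasure D η A ν ∧
              ∀ n : ℕ, (N : ℝ) ^ ((3 : ℝ) / 5) ≤ n → n ≤ N →
                1 + ∑ i, vonMangoldtW (primorial w) (b i) n ≤ M * ν (n : ZMod N')

open Classical in
/-- **Generalised von Neumann theorem** (Green–Tao 2010, Prop. 7.1, as printed: "Let `s,t,d,L`
be positive integer parameters as usual. Then there are constants `C₁` and `D`, depending on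
`s,t,d` and `L`, such that the following is true. Let `C₁ ≤ C ≤ O_{s,t,d,L}(1)` be arbitrary
and suppose that `N' ∈ [CN, 2CN]` is a prime. Let `ν : ℤ_{N'} → ℝ⁺` be a `D`-pseudorandom
measure, and suppose that `f₁, …, f_t : [N] → ℝ` are functions with `|fᵢ(x)| ≤ ν(x)` for all
`i ∈ [t]` and `x ∈ [N]`. Suppose that `Ψ = (ψ₁, …, ψ_t)` is a system of affine-linear forms in
`s`-normal form with `‖Ψ‖_N ≤ L`. Let `K ⊆ [-N,N]^d` be a convex body such that
`Ψ(K) ⊆ [N]^t`. Suppose also that `min_{1 ≤ j ≤ t} ‖fⱼ‖_{U^{s+1}[N]} ≤ δ` for some `δ > 0`.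
Then we have `∑_{n ∈ K} ∏_{i ∈ [t]} fᵢ(ψᵢ(n)) = o_{δ,C}(N^d) + κ_C(δ) N^d`." — `κ(δ) → 0` as
`δ → 0`, the sum being over `K ∩ ℤ^d`; proof in App. C). Rendered with the quantitative
pseudorandomness of this file: for every `ε > 0` there are `δ, η > 0` and `N₀` (depending on
`s,t,d,L,C`, the moment constants `A`, and `ε`) such that the sum is at most `ε N^d` whenever
`N ≥ N₀`, `ν` is `D`-pseudorandom with error `η`, and some `‖fⱼ‖_{U^{s+1}[N]} ≤ δ`
(functions on `[N]` are read off functions on `ℤ`; `[N] ↪ ℤ_{N'}` by reduction).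
[cite: GreenTao2010, Prop. 7.1 and App. C] -/
def GreenTao2010_generalisedVonNeumann : Prop :=
  ∀ (s t d L : ℕ), 1 ≤ s → 1 ≤ t → 1 ≤ d → 1 ≤ L → ∃ C₁ : ℝ, 0 < C₁ ∧ ∃ D : ℕ, 1 ≤ D ∧
    ∀ C : ℝ, C₁ ≤ C → ∀ A : ℕ → ℝ → ℝ, ∀ ε : ℝ, 0 < ε →
      ∃ δ : ℝ, 0 < δ ∧ ∃ η : ℝ, 0 < η ∧ ∃ N₀ : ℕ, ∀ N : ℕ, N₀ ≤ N →
        ∀ (N' : ℕ) [NeZero N'], N'.Prime → C * N ≤ (N' : ℝ) → (N' : ℝ) ≤ 2 * C * N →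
          ∀ ν : ZMod N' → ℝ, IsPseudorandomMeasure D η A ν →
            ∀ f : Fin t → ℤ → ℝ, (∀ i, ∀ x : ℤ, 1 ≤ x → x ≤ N → |f i x| ≤ ν (x : ZMod N')) →
              ∀ Ψ : Fin t → AffLinForm d, IsNondegenerateSystem Ψ → IsNormalForm s Ψ →
                affLinSize Ψ N ≤ L →
                ∀ K : Set (Fin d → ℝ), Convex ℝ K → K ⊆ realBox d N →
                  (∀ x ∈ K, ∀ i, 1 ≤ (Ψ i).realEval x ∧ (Ψ i).realEval x ≤ N) →
                  (∃ j, uniformityNorm (s + 1) N (fun n => ((f j n : ℝ) : ℂ)) ≤ δ) →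
                    |∑ n ∈ (latticeBox d N).filter (fun n => realPoint n ∈ K),
                        ∏ i, f i ((Ψ i).eval n)| ≤ ε * (N : ℝ) ^ d

/-! ### Gowers norms: homogeneity and the effect of modifying a function on a short interval -/

/-- `𝒞^m (c z) = c 𝒞^m z` for real `c`. [folklore] -/
theorem conjPow_ofReal_mul (m : ℕ) (c : ℝ) (z : ℂ) :
    conjPow m ((c : ℂ) * z) = (c : ℂ) * conjPow m z := by
  unfold conjPow
  split_ifs <;> simp

/-- `|𝒞^m z| = |z|`. [folklore] -/
theorem norm_conjPow (m : ℕ) (z : ℂ) : ‖conjPow m z‖ = ‖z‖ := by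
  unfold conjPow
  split_ifs <;> simp

/-- Homogeneity of the cube product: `∏_ω 𝒞^{|ω|}(c f) = c^{2^k} ∏_ω 𝒞^{|ω|} f`. [folklore] -/
theorem gowersCubeTerm_ofReal_mul (k : ℕ) (c : ℝ) (f : ℤ → ℂ) (x : ℤ) (h : Fin k → ℤ) :
    gowersCubeTerm k (fun y => (c : ℂ) * f y) x h = (c : ℂ) ^ 2 ^ k * gowersCubeTerm k f x h := by
  unfold gowersCubeTerm
  simp_rw [conjPow_ofReal_mul]
  rw [Finset.prod_mul_distrib, Finset.prod_const, Finset.card_univ, Fintype.card_finset,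
    Fintype.card_fin]

/-- Homogeneity of the Gowers average: `avg(c f) = c^{2^k} avg(f)`. [folklore] -/
theorem uniformityAvg_ofReal_mul (k N : ℕ) (c : ℝ) (f : ℤ → ℂ) :
    uniformityAvg k N (fun y => (c : ℂ) * f y) = (c : ℂ) ^ 2 ^ k * uniformityAvg k N f := by
  unfold uniformityAvg
  simp_rw [gowersCubeTerm_ofReal_mul, ← Finset.mul_sum, mul_div_assoc]

/-- Homogeneity of the Gowers norm: `‖c f‖_{U^k[N]} = c ‖f‖_{U^k[N]}` for `c ≥ 0`.
[cite: GreenTao2010, App. B] -/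
theorem uniformityNorm_ofReal_mul (k N : ℕ) {c : ℝ} (hc : 0 ≤ c) (f : ℤ → ℂ) :
    uniformityNorm k N (fun y => (c : ℂ) * f y) = c * uniformityNorm k N f := by
  unfold uniformityNorm
  rw [uniformityAvg_ofReal_mul, norm_mul, norm_pow, Complex.norm_real, Real.norm_of_nonneg hc,
    Real.mul_rpow (by positivity) (norm_nonneg _)]
  congr 1
  have h2 : ((2 : ℝ) ^ k) = ((2 ^ k : ℕ) : ℝ) := by push_cast; ring
  rw [h2, Real.pow_rpow_inv_natCast hc (by positivity)]

/-- Cube products of functions agreeing at all vertices agree. [folklore] -/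
theorem gowersCubeTerm_congr {k : ℕ} {f g : ℤ → ℂ} {x : ℤ} {h : Fin k → ℤ}
    (hfg : ∀ ω : Finset (Fin k), f (cubeVertex x h ω) = g (cubeVertex x h ω)) :
    gowersCubeTerm k f x h = gowersCubeTerm k g x h :=
  Finset.prod_congr rfl fun ω _ => by rw [hfg ω]

/-- A cube in `[N]` of a function bounded by `B` on `[N]` has product at most `B^{2^k}`.
[folklore] -/
theorem norm_gowersCubeTerm_le {k N : ℕ} {f : ℤ → ℂ} {B : ℝ}
    (hf : ∀ x : ℤ, 1 ≤ x → x ≤ N → ‖f x‖ ≤ B) {x : ℤ} {h : Fin k → ℤ}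
    (hp : (x, h) ∈ gowersCubeParams k N) : ‖gowersCubeTerm k f x h‖ ≤ B ^ 2 ^ k := by
  unfold gowersCubeTerm
  rw [norm_prod]
  calc ∏ ω, ‖conjPow ω.card (f (cubeVertex x h ω))‖ ≤ ∏ _ω : Finset (Fin k), B :=
        Finset.prod_le_prod (fun _ _ => norm_nonneg _) fun ω _ => by
          rw [norm_conjPow]
          have hv := Finset.mem_Icc.mp (mem_gowersCubeParams.mp hp ω)
          exact hf _ hv.1 hv.2
    _ = B ^ 2 ^ k := by
        rw [Finset.prod_const, Finset.card_univ, Fintype.card_finset, Fintype.card_fin]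

/-- The parameters of cubes in `[N]` having the vertex `ω` in `[1, m]` number at most
`m (2N+1)^k` (for fixed `h`, `x ↦ x + ω·h` is injective). [folklore] -/
theorem card_gowersCubeParams_vertex_le (k N m : ℕ) (ω : Finset (Fin k)) :
    (((gowersCubeParams k N).filter fun p => cubeVertex p.1 p.2 ω ≤ (m : ℤ)).card : ℝ) ≤
      m * (2 * N + 1) ^ k := by
  classical
  set S := (gowersCubeParams k N).filter fun p => cubeVertex p.1 p.2 ω ≤ (m : ℤ)
  set T : Finset (ℤ × (Fin k → ℤ)) :=
    (Icc (1 : ℤ) m) ×ˢ Fintype.piFinset fun _ : Fin k => Icc (-(N : ℤ)) N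
  have hmaps : Set.MapsTo (fun p : ℤ × (Fin k → ℤ) => (cubeVertex p.1 p.2 ω, p.2)) S T := by
    intro p hp
    have hp' := Finset.mem_filter.mp hp
    have hP : (p.1, p.2) ∈ gowersCubeParams k N := hp'.1
    have hv := Finset.mem_Icc.mp (mem_gowersCubeParams.mp hP ω)
    have hbox := (Finset.mem_filter.mp hP).1
    rw [Finset.mem_product] at hbox
    refine Finset.mem_product.mpr ⟨Finset.mem_Icc.mpr ⟨hv.1, hp'.2⟩, hbox.2⟩
  have hinj : Set.InjOn (fun p : ℤ × (Fin k → ℤ) => (cubeVertex p.1 p.2 ω, p.2)) S := by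
    intro p _ q _ hpq
    simp only [Prod.mk.injEq] at hpq
    obtain ⟨h1, h2⟩ := hpq
    have : p.1 = q.1 := by
      unfold cubeVertex at h1
      rw [h2] at h1
      linarith
    exact Prod.ext this h2
  have hcard := Finset.card_le_card_of_injOn _ hmaps hinj
  have hT : T.card = m * (2 * N + 1) ^ k := by
    rw [Finset.card_product, Int.card_Icc, Fintype.card_piFinset, Finset.prod_const,
      Finset.card_univ, Fintype.card_fin, Int.card_Icc]
    congr 1
    · simp
    · congr 1
      omega
  calc ((S.card : ℕ) : ℝ) ≤ T.card := by exact_mod_cast hcard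
    _ = m * (2 * N + 1) ^ k := by rw [hT]; push_cast; ring

/-- **Modifying a bounded function on `[1, m]` moves the Gowers average by little**: if
`|f|, |g| ≤ B` on `[N]` and `f = g` on `(m, N]`, then
`|avg f - avg g| ≤ 2^k m (2N+1)^k · 2B^{2^k} / #(cubes in [N])` (only cubes with a vertex in
`[1, m]` contribute). (Elementary, from the definition (B.11) of
[cite: GreenTao2010, App. B (B.11)].) [folklore] -/
theorem norm_uniformityAvg_sub_le_card {k N m : ℕ} {f g : ℤ → ℂ} {B : ℝ} (hB : 0 ≤ B)
    (hf : ∀ x : ℤ, 1 ≤ x → x ≤ N → ‖f x‖ ≤ B) (hg : ∀ x : ℤ, 1 ≤ x → x ≤ N → ‖g x‖ ≤ B)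
    (hfg : ∀ x : ℤ, (m : ℤ) < x → x ≤ N → f x = g x) :
    ‖uniformityAvg k N f - uniformityAvg k N g‖ ≤
      2 ^ k * m * (2 * N + 1) ^ k * (2 * B ^ 2 ^ k) / (gowersCubeParams k N).card := by
  classical
  set P := gowersCubeParams k N
  set bad := P.filter fun p => ∃ ω : Finset (Fin k), cubeVertex p.1 p.2 ω ≤ (m : ℤ)
  have hsum : ∑ p ∈ P, (gowersCubeTerm k f p.1 p.2 - gowersCubeTerm k g p.1 p.2) =
      ∑ p ∈ bad, (gowersCubeTerm k f p.1 p.2 - gowersCubeTerm k g p.1 p.2) := by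
    symm
    apply Finset.sum_subset (Finset.filter_subset _ _)
    intro p hp hpbad
    rw [sub_eq_zero]
    apply gowersCubeTerm_congr
    intro ω
    have hv := Finset.mem_Icc.mp (mem_gowersCubeParams.mp (show (p.1, p.2) ∈ _ from hp) ω)
    refine hfg _ ?_ hv.2
    by_contra hle
    push Not at hle
    exact hpbad (Finset.mem_filter.mpr ⟨hp, ω, hle⟩)
  have hdiff : uniformityAvg k N f - uniformityAvg k N g =
      (∑ p ∈ bad, (gowersCubeTerm k f p.1 p.2 - gowersCubeTerm k g p.1 p.2)) / P.card := by
    unfold uniformityAvg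
    rw [← sub_div, ← Finset.sum_sub_distrib, hsum]
  -- the number of bad cubes
  have hbad : (bad.card : ℝ) ≤ 2 ^ k * m * (2 * N + 1) ^ k := by
    have hsub : bad ⊆ (Finset.univ : Finset (Finset (Fin k))).biUnion
        fun ω => P.filter fun p => cubeVertex p.1 p.2 ω ≤ (m : ℤ) := by
      intro p hp
      obtain ⟨hpP, ω, hω⟩ := Finset.mem_filter.mp hp
      exact Finset.mem_biUnion.mpr ⟨ω, Finset.mem_univ _, Finset.mem_filter.mpr ⟨hpP, hω⟩⟩
    calc (bad.card : ℝ) ≤ ((Finset.univ : Finset (Finset (Fin k))).biUnion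
          fun ω => P.filter fun p => cubeVertex p.1 p.2 ω ≤ (m : ℤ)).card := by
          exact_mod_cast Finset.card_le_card hsub
      _ ≤ ∑ ω : Finset (Fin k), ((P.filter fun p => cubeVertex p.1 p.2 ω ≤ (m : ℤ)).card : ℝ) := by
          exact_mod_cast Finset.card_biUnion_le
      _ ≤ ∑ _ω : Finset (Fin k), (m : ℝ) * (2 * N + 1) ^ k :=
          Finset.sum_le_sum fun ω _ => card_gowersCubeParams_vertex_le k N m ω
      _ = 2 ^ k * m * (2 * N + 1) ^ k := by
          rw [Finset.sum_const, Finset.card_univ, Fintype.card_finset, Fintype.card_fin,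
            nsmul_eq_mul]
          push_cast
          ring
  -- each bad cube contributes at most `2 B^{2^k}`
  have hterm : ∀ p ∈ bad, ‖gowersCubeTerm k f p.1 p.2 - gowersCubeTerm k g p.1 p.2‖ ≤
      2 * B ^ 2 ^ k := by
    intro p hp
    have hpP : (p.1, p.2) ∈ gowersCubeParams k N := (Finset.mem_filter.mp hp).1
    calc ‖gowersCubeTerm k f p.1 p.2 - gowersCubeTerm k g p.1 p.2‖
        ≤ ‖gowersCubeTerm k f p.1 p.2‖ + ‖gowersCubeTerm k g p.1 p.2‖ := norm_sub_le _ _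
      _ ≤ B ^ 2 ^ k + B ^ 2 ^ k :=
          add_le_add (norm_gowersCubeTerm_le hf hpP) (norm_gowersCubeTerm_le hg hpP)
      _ = 2 * B ^ 2 ^ k := by ring
  have hnum : ‖∑ p ∈ bad, (gowersCubeTerm k f p.1 p.2 - gowersCubeTerm k g p.1 p.2)‖ ≤
      2 ^ k * m * (2 * N + 1) ^ k * (2 * B ^ 2 ^ k) := by
    calc _ ≤ ∑ p ∈ bad, ‖gowersCubeTerm k f p.1 p.2 - gowersCubeTerm k g p.1 p.2‖ :=
          norm_sum_le _ _
      _ ≤ ∑ _p ∈ bad, 2 * B ^ 2 ^ k := Finset.sum_le_sum hterm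
      _ = bad.card * (2 * B ^ 2 ^ k) := by rw [Finset.sum_const, nsmul_eq_mul]
      _ ≤ _ := mul_le_mul_of_nonneg_right hbad (by positivity)
  rw [hdiff, norm_div]
  by_cases hP : P.card = 0
  · simp [hP]
  · rw [show ‖(P.card : ℂ)‖ = (P.card : ℝ) by simp]
    exact div_le_div_of_nonneg_right hnum (by positivity)

/-- There are at least `n₀^{k+1}` cubes in `[N]` when `(k+1) n₀ ≤ N` (`x ∈ [1, n₀]`,
`hⱼ ∈ [0, n₀ - 1]`). [folklore] -/
theorem pow_le_card_gowersCubeParams {k N n₀ : ℕ} (hn : (k + 1) * n₀ ≤ N) :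
    n₀ ^ (k + 1) ≤ (gowersCubeParams k N).card := by
  classical
  set S : Finset (ℤ × (Fin k → ℤ)) :=
    (Icc (1 : ℤ) n₀) ×ˢ Fintype.piFinset fun _ : Fin k => Icc (0 : ℤ) ((n₀ : ℤ) - 1)
  have hS : S ⊆ gowersCubeParams k N := by
    intro p hp
    rw [Finset.mem_product] at hp
    obtain ⟨hx, hh⟩ := hp
    rw [Finset.mem_Icc] at hx
    have hh' : ∀ j, 0 ≤ p.2 j ∧ p.2 j ≤ (n₀ : ℤ) - 1 := fun j =>
      Finset.mem_Icc.mp (Fintype.mem_piFinset.mp hh j)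
    have key : (p.1, p.2) ∈ gowersCubeParams k N := by
      refine mem_gowersCubeParams.mpr fun ω => Finset.mem_Icc.mpr ⟨?_, ?_⟩
      · have : 0 ≤ ∑ j ∈ ω, p.2 j := Finset.sum_nonneg fun j _ => (hh' j).1
        unfold cubeVertex
        linarith
      · have h1 : ∑ j ∈ ω, p.2 j ≤ ∑ j, p.2 j :=
          Finset.sum_le_sum_of_subset_of_nonneg (Finset.subset_univ _) fun j _ _ => (hh' j).1
        have h2 : ∑ j : Fin k, p.2 j ≤ ∑ _j : Fin k, ((n₀ : ℤ) - 1) :=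
          Finset.sum_le_sum fun j _ => (hh' j).2
        rw [Finset.sum_const, Finset.card_univ, Fintype.card_fin, nsmul_eq_mul] at h2
        have h3 : ((k + 1) * n₀ : ℕ) ≤ (N : ℤ) := by exact_mod_cast hn
        push_cast at h3
        unfold cubeVertex
        nlinarith
    exact key
  have hcard : S.card = n₀ ^ (k + 1) := by
    rw [Finset.card_product, Int.card_Icc, Fintype.card_piFinset, Finset.prod_const,
      Finset.card_univ, Fintype.card_fin, Int.card_Icc, pow_succ']
    congr 1
    · simp
    · congr 1
      omega
  calc n₀ ^ (k + 1) = S.card := hcard.symm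
    _ ≤ _ := Finset.card_le_card hS

/-- The constant `c_k = 2^{k+1} 3^k (2k+2)^{k+1}` of `norm_uniformityAvg_sub_le`. [folklore] -/
def gowersPerturbConst (k : ℕ) : ℝ :=
  2 ^ (k + 1) * 3 ^ k * (2 * k + 2) ^ (k + 1)

/-- `c_k > 0`. [folklore] -/
theorem gowersPerturbConst_pos (k : ℕ) : 0 < gowersPerturbConst k := by
  unfold gowersPerturbConst; positivity

/-- **Modifying a bounded function on `[1, m]`**, final form: for `N ≥ 2(k+1)`, if
`|f|, |g| ≤ B` on `[N]` and `f = g` on `(m, N]`, then `|avg f - avg g| ≤ c_k B^{2^k} m / N`.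
(Elementary, from the definition (B.11) of
[cite: GreenTao2010, App. B (B.11)].) [folklore] -/
theorem norm_uniformityAvg_sub_le {k N m : ℕ} (hN : 2 * (k + 1) ≤ N) {f g : ℤ → ℂ} {B : ℝ}
    (hB : 0 ≤ B) (hf : ∀ x : ℤ, 1 ≤ x → x ≤ N → ‖f x‖ ≤ B)
    (hg : ∀ x : ℤ, 1 ≤ x → x ≤ N → ‖g x‖ ≤ B)
    (hfg : ∀ x : ℤ, (m : ℤ) < x → x ≤ N → f x = g x) :
    ‖uniformityAvg k N f - uniformityAvg k N g‖ ≤ gowersPerturbConst k * B ^ 2 ^ k * m / N := by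
  have h1 := norm_uniformityAvg_sub_le_card (k := k) hB hf hg hfg
  set n₀ := N / (k + 1) with hn₀
  have hkn : (k + 1) * n₀ ≤ N := by rw [hn₀, mul_comm]; exact Nat.div_mul_le_self N (k + 1)
  have hP := pow_le_card_gowersCubeParams hkn
  have hNr : (0 : ℝ) < N := by exact_mod_cast (by omega : 0 < N)
  have hk1 : (0 : ℝ) < k + 1 := by positivity
  -- `n₀ ≥ N / (2(k+1))`
  have hn₀r : (N : ℝ) / (2 * (k + 1)) ≤ n₀ := by
    have hdiv : (N : ℝ) / (k + 1) - 1 ≤ n₀ := by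
      have h := Nat.div_add_mod N (k + 1)
      have hmod := Nat.mod_lt N (show 0 < k + 1 by omega)
      have h' : ((k + 1) * n₀ + N % (k + 1) : ℕ) = N := by rw [hn₀]; exact h
      have h'' : ((k + 1 : ℕ) : ℝ) * n₀ + (N % (k + 1) : ℕ) = N := by exact_mod_cast h'
      have hmod' : ((N % (k + 1) : ℕ) : ℝ) ≤ k + 1 := by
        exact_mod_cast hmod.le
      rw [div_sub_one (ne_of_gt hk1), div_le_iff₀ hk1]
      push_cast at h''
      nlinarith
    have h2 : (2 * (k + 1) : ℕ) ≤ (N : ℝ) := by exact_mod_cast hN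
    push_cast at h2
    rw [div_le_iff₀ (by positivity)]
    rw [div_sub_one (ne_of_gt hk1), div_le_iff₀ hk1] at hdiv
    nlinarith
  have hn₀pos : (0 : ℝ) < n₀ := lt_of_lt_of_le (by positivity) hn₀r
  have hPr : ((N : ℝ) / (2 * (k + 1))) ^ (k + 1) ≤ (gowersCubeParams k N).card := by
    calc ((N : ℝ) / (2 * (k + 1))) ^ (k + 1) ≤ (n₀ : ℝ) ^ (k + 1) :=
          pow_le_pow_left₀ (by positivity) hn₀r _
      _ ≤ _ := by exact_mod_cast hP
  have hPpos : (0 : ℝ) < (gowersCubeParams k N).card := lt_of_lt_of_le (by positivity) hPr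
  -- combine
  have hnum0 : (0 : ℝ) ≤ 2 ^ k * m * (2 * N + 1) ^ k * (2 * B ^ 2 ^ k) := by positivity
  calc ‖uniformityAvg k N f - uniformityAvg k N g‖
      ≤ 2 ^ k * m * (2 * N + 1) ^ k * (2 * B ^ 2 ^ k) / (gowersCubeParams k N).card := h1
    _ ≤ 2 ^ k * m * (2 * N + 1) ^ k * (2 * B ^ 2 ^ k) / ((N : ℝ) / (2 * (k + 1))) ^ (k + 1) :=
        div_le_div_of_nonneg_left hnum0 (by positivity) hPr
    _ ≤ 2 ^ k * m * (3 * N) ^ k * (2 * B ^ 2 ^ k) / ((N : ℝ) / (2 * (k + 1))) ^ (k + 1) := by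
        gcongr
        have : (1 : ℝ) ≤ N := by exact_mod_cast (by omega : 1 ≤ N)
        linarith
    _ = gowersPerturbConst k * B ^ 2 ^ k * m / N := by
        unfold gowersPerturbConst
        rw [div_pow, mul_pow, pow_succ (N : ℝ) k]
        field_simp
        ring

/-- From averages to norms: `‖f‖_{U^k[N]} ≤ ‖g‖_{U^k[N]} + Δ^{1/2^k}` when
`|avg f - avg g| ≤ Δ` (monotonicity and subadditivity of `x ↦ x^{1/2^k}`). [folklore] -/
theorem uniformityNorm_le_add_rpow {k N : ℕ} {f g : ℤ → ℂ} {Δ : ℝ} (hΔ : 0 ≤ Δ)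
    (h : ‖uniformityAvg k N f - uniformityAvg k N g‖ ≤ Δ) :
    uniformityNorm k N f ≤ uniformityNorm k N g + Δ ^ ((2 : ℝ) ^ k)⁻¹ := by
  unfold uniformityNorm
  have h1 : ‖uniformityAvg k N f‖ ≤ ‖uniformityAvg k N g‖ + Δ := by
    calc ‖uniformityAvg k N f‖
        = ‖uniformityAvg k N g + (uniformityAvg k N f - uniformityAvg k N g)‖ := by
          congr 1; ring
      _ ≤ ‖uniformityAvg k N g‖ + ‖uniformityAvg k N f - uniformityAvg k N g‖ := norm_add_le _ _
      _ ≤ _ := by linarith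
  have hp0 : 0 ≤ ((2 : ℝ) ^ k)⁻¹ := by positivity
  have hp1 : ((2 : ℝ) ^ k)⁻¹ ≤ 1 := inv_le_one_of_one_le₀ (one_le_pow₀ (by norm_num))
  calc ‖uniformityAvg k N f‖ ^ ((2 : ℝ) ^ k)⁻¹
      ≤ (‖uniformityAvg k N g‖ + Δ) ^ ((2 : ℝ) ^ k)⁻¹ := Real.rpow_le_rpow (norm_nonneg _) h1 hp0
    _ ≤ _ := Real.rpow_add_le_add_rpow (norm_nonneg _) hΔ hp0 hp1

/-! ### Numerical lemmas -/

/-- In the admissible range `w ≤ ½ log log N` the modulus is small: `W = ∏_{p ≤ w} p ≤ N`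
(`W ≤ 4^w ≤ e^{log log N} = log N ≤ N`). [cite: GreenTao2010, §5 ("any function such that
`w(N) ≤ ½ log log N` … would suffice")] -/
theorem primorial_le_of_le_logLog {N w : ℕ} (hN : 2 ≤ N)
    (hw : (w : ℝ) ≤ Real.log (Real.log N) / 2) : (primorial w : ℝ) ≤ N := by
  have hNr : (2 : ℝ) ≤ N := by exact_mod_cast hN
  have hlogN : 0 < Real.log N := Real.log_pos (by linarith)
  have h2w : 2 * (w : ℝ) ≤ Real.log (Real.log N) := by linarith
  have hll : 0 ≤ Real.log (Real.log N) := le_trans (by positivity) h2w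
  have h4 : (primorial w : ℝ) ≤ (4 : ℝ) ^ w := by exact_mod_cast primorial_le_four_pow w
  have hlog2 : Real.log 2 < 1 := by
    have := Real.log_two_lt_d9; norm_num at this; linarith
  have h4exp : (4 : ℝ) ^ w = Real.exp (2 * w * Real.log 2) := by
    rw [← Real.rpow_natCast, Real.rpow_def_of_pos (by norm_num : (0 : ℝ) < 4)]
    congr 1
    have : Real.log 4 = 2 * Real.log 2 := by
      rw [show (4 : ℝ) = 2 ^ 2 by norm_num, Real.log_pow]; push_cast; ring
    rw [this]; ring
  have hexp : Real.exp (2 * w * Real.log 2) ≤ Real.log N := by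
    calc Real.exp (2 * w * Real.log 2) ≤ Real.exp (Real.log (Real.log N)) := by
          apply Real.exp_le_exp.mpr
          calc 2 * (w : ℝ) * Real.log 2 ≤ Real.log (Real.log N) * Real.log 2 :=
                mul_le_mul_of_nonneg_right h2w (Real.log_nonneg (by norm_num))
            _ ≤ Real.log (Real.log N) * 1 := mul_le_mul_of_nonneg_left hlog2.le hll
            _ = _ := mul_one _
      _ = Real.log N := Real.exp_log hlogN
  have hlogle : Real.log N ≤ N := (Real.log_le_sub_one_of_pos (by linarith)).trans (by linarith)
  linarith

/-- `log log` is monotone on `[2, ∞)`: the admissible range of cutoffs only grows with the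
scale. [folklore] -/
theorem logLog_mono {N N' : ℕ} (hN : 2 ≤ N) (hNN' : N ≤ N') :
    Real.log (Real.log N) ≤ Real.log (Real.log N') := by
  have hNr : (2 : ℝ) ≤ N := by exact_mod_cast hN
  have hNN'r : (N : ℝ) ≤ N' := by exact_mod_cast hNN'
  exact Real.log_le_log (Real.log_pos (by linarith)) (Real.log_le_log (by linarith) hNN'r)

/-- `0 ≤ Λ'_{b,W}(n) ≤ log(Wn + b)` (`φ(W) ≤ W`, `Λ' ≤ Λ ≤ log`). [cite: GreenTao2010, §5] -/
theorem vonMangoldtW_nonneg_le_log (W b n : ℕ) :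
    0 ≤ vonMangoldtW W b n ∧ vonMangoldtW W b n ≤ Real.log ((W * n + b : ℕ) : ℝ) := by
  unfold vonMangoldtW
  have hφ : (Nat.totient W : ℝ) / W ≤ 1 := by
    rcases Nat.eq_zero_or_pos W with hW | hW
    · simp [hW]
    · rw [div_le_one (by exact_mod_cast hW)]
      exact_mod_cast Nat.totient_le W
  have hφ0 : 0 ≤ (Nat.totient W : ℝ) / W := by positivity
  have hΛ := vonMangoldtPrime_le_vonMangoldt (W * n + b)
  have hlog : vonMangoldtPrime (W * n + b) ≤ Real.log ((W * n + b : ℕ) : ℝ) :=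
    hΛ.2.trans ArithmeticFunction.vonMangoldt_le_log
  refine ⟨mul_nonneg hφ0 hΛ.1, ?_⟩
  calc (Nat.totient W : ℝ) / W * vonMangoldtPrime (W * n + b)
      ≤ 1 * vonMangoldtPrime (W * n + b) := mul_le_mul_of_nonneg_right hφ hΛ.1
    _ ≤ _ := by rw [one_mul]; exact hlog

/-- On `[N]`, with `W ≤ N` and `b ≤ W`: `|Λ'_{b,W}(x) - 1| ≤ 1 + 2 log(N + 1)`. [folklore] -/
theorem abs_vonMangoldtW_sub_one_le {W b N : ℕ} (hWN : W ≤ N) (hb : b ≤ W) {x : ℤ}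
    (hx1 : 1 ≤ x) (hxN : x ≤ N) :
    |vonMangoldtW W b x.toNat - 1| ≤ 1 + 2 * Real.log ((N : ℝ) + 1) := by
  obtain ⟨h0, hle⟩ := vonMangoldtW_nonneg_le_log W b x.toNat
  have hxN' : x.toNat ≤ N := by omega
  have hN0 : (0 : ℝ) ≤ N := by positivity
  have harg : ((W * x.toNat + b : ℕ) : ℝ) ≤ ((N : ℝ) + 1) ^ 2 := by
    have h1 : W * x.toNat + b ≤ N * N + N := by nlinarith
    have h2 : ((W * x.toNat + b : ℕ) : ℝ) ≤ ((N * N + N : ℕ) : ℝ) := by exact_mod_cast h1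
    have h3 : ((N * N + N : ℕ) : ℝ) ≤ ((N : ℝ) + 1) ^ 2 := by push_cast; nlinarith
    exact h2.trans h3
  have hlog1 : 0 ≤ Real.log ((N : ℝ) + 1) := Real.log_nonneg (by linarith)
  have hlog : Real.log ((W * x.toNat + b : ℕ) : ℝ) ≤ 2 * Real.log ((N : ℝ) + 1) := by
    rcases Nat.eq_zero_or_pos (W * x.toNat + b) with hz | hz
    · rw [hz]; simp only [Nat.cast_zero, Real.log_zero]; linarith
    · calc Real.log ((W * x.toNat + b : ℕ) : ℝ) ≤ Real.log (((N : ℝ) + 1) ^ 2) :=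
            Real.log_le_log (by exact_mod_cast hz) harg
        _ = 2 * Real.log ((N : ℝ) + 1) := by rw [Real.log_pow]; push_cast; ring
  rw [abs_le]
  constructor <;> nlinarith [Real.log_nonneg (by linarith : (1 : ℝ) ≤ (N : ℝ) + 1)]

/-- The decay used for the Gowers-norm cut: for `c ≥ 0`, `κ > 0` and `P`, eventually
`c (1 + 2 log(n+1))^P (n^{3/5} + 1) / n ≤ κ`. [folklore] -/
theorem logPow_cut_eventually {c κ : ℝ} (hc : 0 ≤ c) (hκ : 0 < κ) (P : ℕ) :
    ∃ N₀ : ℕ, ∀ n : ℕ, N₀ ≤ n →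
      c * (1 + 2 * Real.log ((n : ℝ) + 1)) ^ P * ((n : ℝ) ^ ((3 : ℝ) / 5) + 1) / n ≤ κ := by
  set δ : ℝ := 1 / (5 * (P + 1)) with hδ
  have hδ0 : 0 < δ := by positivity
  have hδ1 : δ ≤ 1 := by
    rw [hδ, div_le_one (by positivity)]
    have : (0 : ℝ) ≤ P := by positivity
    linarith
  have hδP : δ * P ≤ 1 / 5 := by
    rw [hδ, div_mul_eq_mul_div, one_mul, div_le_div_iff₀ (by positivity) (by norm_num)]
    have : (P : ℝ) ≤ P + 1 := by linarith
    nlinarith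
  set C' : ℝ := c * (2 * (1 + 2 / δ)) ^ P * 2 + 1 with hC'
  have hC'0 : 0 < C' := by positivity
  refine ⟨⌈(C' / κ) ^ (5 : ℕ)⌉₊ + 1, fun n hn => ?_⟩
  have hn1 : (1 : ℝ) ≤ n := by exact_mod_cast (by omega : 1 ≤ n)
  have hn0 : (0 : ℝ) < n := by linarith
  set x : ℝ := (n : ℝ) with hx
  -- `1 + 2 log(x+1) ≤ 2(1 + 2/δ) x^δ`
  have h1 : 1 + 2 * Real.log (x + 1) ≤ 2 * (1 + 2 / δ) * x ^ δ := by
    have hlog := Real.log_le_rpow_div (by linarith : (0 : ℝ) ≤ x + 1) hδ0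
    have hx1δ : (x + 1) ^ δ ≤ 2 * x ^ δ := by
      calc (x + 1) ^ δ ≤ (2 * x) ^ δ := Real.rpow_le_rpow (by linarith) (by linarith) hδ0.le
        _ = (2 : ℝ) ^ δ * x ^ δ := Real.mul_rpow (by norm_num) hn0.le
        _ ≤ 2 * x ^ δ := by
            refine mul_le_mul_of_nonneg_right ?_ (Real.rpow_nonneg hn0.le _)
            calc (2 : ℝ) ^ δ ≤ (2 : ℝ) ^ (1 : ℝ) :=
                  Real.rpow_le_rpow_of_exponent_le (by norm_num) hδ1
              _ = 2 := Real.rpow_one 2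
    have hxδ1 : 1 ≤ x ^ δ := Real.one_le_rpow hn1 hδ0.le
    calc 1 + 2 * Real.log (x + 1) ≤ 1 + 2 * ((x + 1) ^ δ / δ) := by linarith
      _ ≤ x ^ δ + 2 * (2 * x ^ δ / δ) := by
          gcongr
      _ ≤ 2 * (1 + 2 / δ) * x ^ δ := by
          have hxδ0 : 0 ≤ x ^ δ := by positivity
          have key : 2 * (1 + 2 / δ) * x ^ δ - (x ^ δ + 2 * (2 * x ^ δ / δ)) = x ^ δ := by ring
          linarith [key]
  have hlog0 : 0 ≤ 1 + 2 * Real.log (x + 1) := by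
    have : 0 ≤ Real.log (x + 1) := Real.log_nonneg (by linarith)
    linarith
  have h1P : (1 + 2 * Real.log (x + 1)) ^ P ≤ (2 * (1 + 2 / δ)) ^ P * x ^ ((1 : ℝ) / 5) := by
    calc (1 + 2 * Real.log (x + 1)) ^ P ≤ (2 * (1 + 2 / δ) * x ^ δ) ^ P :=
          pow_le_pow_left₀ hlog0 h1 P
      _ = (2 * (1 + 2 / δ)) ^ P * x ^ (δ * P) := by
          rw [mul_pow, Real.rpow_mul hn0.le, Real.rpow_natCast]
      _ ≤ (2 * (1 + 2 / δ)) ^ P * x ^ ((1 : ℝ) / 5) :=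
          mul_le_mul_of_nonneg_left (Real.rpow_le_rpow_of_exponent_le hn1 hδP) (by positivity)
  have h2 : x ^ ((3 : ℝ) / 5) + 1 ≤ 2 * x ^ ((3 : ℝ) / 5) := by
    have : 1 ≤ x ^ ((3 : ℝ) / 5) := Real.one_le_rpow hn1 (by norm_num)
    linarith
  -- combine: LHS ≤ C' x^{-1/5}
  have hLHS : c * (1 + 2 * Real.log (x + 1)) ^ P * (x ^ ((3 : ℝ) / 5) + 1) / x ≤
      C' * x ^ (-(1 : ℝ) / 5) := by
    have step : c * (1 + 2 * Real.log (x + 1)) ^ P * (x ^ ((3 : ℝ) / 5) + 1) ≤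
        c * ((2 * (1 + 2 / δ)) ^ P * x ^ ((1 : ℝ) / 5)) * (2 * x ^ ((3 : ℝ) / 5)) :=
      mul_le_mul (mul_le_mul_of_nonneg_left h1P hc) h2 (by positivity) (by positivity)
    have hx15 : x ^ ((1 : ℝ) / 5) * x ^ ((3 : ℝ) / 5) / x = x ^ (-(1 : ℝ) / 5) := by
      rw [← Real.rpow_add hn0, div_eq_mul_inv, ← Real.rpow_neg_one x, ← Real.rpow_add hn0]
      norm_num
    calc c * (1 + 2 * Real.log (x + 1)) ^ P * (x ^ ((3 : ℝ) / 5) + 1) / x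
        ≤ c * ((2 * (1 + 2 / δ)) ^ P * x ^ ((1 : ℝ) / 5)) * (2 * x ^ ((3 : ℝ) / 5)) / x :=
          div_le_div_of_nonneg_right step hn0.le
      _ = (c * (2 * (1 + 2 / δ)) ^ P * 2) * (x ^ ((1 : ℝ) / 5) * x ^ ((3 : ℝ) / 5) / x) := by
          ring
      _ = (c * (2 * (1 + 2 / δ)) ^ P * 2) * x ^ (-(1 : ℝ) / 5) := by rw [hx15]
      _ ≤ C' * x ^ (-(1 : ℝ) / 5) := by
          apply mul_le_mul_of_nonneg_right _ (Real.rpow_nonneg hn0.le _)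
          rw [hC']; linarith
  -- `C' x^{-1/5} ≤ κ` since `x ≥ (C'/κ)^5`
  have hx5 : C' / κ ≤ x ^ ((1 : ℝ) / 5) := by
    have hge : (C' / κ) ^ (5 : ℕ) ≤ x := by
      have := Nat.le_ceil ((C' / κ) ^ (5 : ℕ))
      have h' : (⌈(C' / κ) ^ (5 : ℕ)⌉₊ : ℝ) + 1 ≤ x := by rw [hx]; exact_mod_cast hn
      linarith
    have hpos : 0 ≤ C' / κ := by positivity
    calc C' / κ = ((C' / κ) ^ (5 : ℕ)) ^ ((1 : ℝ) / 5) := by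
          rw [← Real.rpow_natCast, ← Real.rpow_mul hpos]
          norm_num
      _ ≤ x ^ ((1 : ℝ) / 5) := Real.rpow_le_rpow (by positivity) hge (by norm_num)
  have hx5' : C' * x ^ (-(1 : ℝ) / 5) ≤ κ := by
    have hx15pos : 0 < x ^ ((1 : ℝ) / 5) := Real.rpow_pos_of_pos hn0 _
    have : x ^ (-(1 : ℝ) / 5) = (x ^ ((1 : ℝ) / 5))⁻¹ := by
      rw [← Real.rpow_neg hn0.le]; norm_num
    rw [this, ← div_eq_mul_inv, div_le_iff₀ hx15pos]
    rw [div_le_iff₀ hκ] at hx5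
    linarith
  exact hLHS.trans hx5'

/-! ### Elementary facts about systems and bodies at two scales -/

/-- `‖Ψ‖_N` is non-increasing in `N`. [cite: GreenTao2010, (1.1)] -/
theorem affLinSize_anti (Ψ : Fin t → AffLinForm d) {N N' : ℝ} (hN : 0 < N) (hNN' : N ≤ N') :
    affLinSize Ψ N' ≤ affLinSize Ψ N := by
  unfold affLinSize
  refine add_le_add le_rfl (Finset.sum_le_sum fun i _ => ?_)
  rw [abs_div, abs_div, abs_of_pos hN, abs_of_pos (lt_of_lt_of_le hN hNN')]
  exact div_le_div_of_nonneg_left (abs_nonneg _) hN hNN'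

/-- On `[-N,N]^d` (real points), `|ψᵢ(x)| ≤ 2LN` when `‖Ψ‖_N ≤ L`.
[cite: GreenTao2010, (1.1)] -/
theorem abs_realEval_le_of_affLinSize_le {Ψ : Fin t → AffLinForm d} {N : ℕ} {L : ℝ}
    (hN : 1 ≤ N) (hL : affLinSize Ψ N ≤ L) {x : Fin d → ℝ} (hx : x ∈ realBox d N) (i : Fin t) :
    |(Ψ i).realEval x| ≤ 2 * L * N := by
  have hN0 : (0 : ℝ) < N := by exact_mod_cast hN
  have hxj : ∀ j, |x j| ≤ N := fun j => abs_le.mpr ⟨hx.1 j, hx.2 j⟩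
  have h1 : ∑ j, |((Ψ i).coeff j : ℝ)| ≤ L := by
    have ha : ∑ j, |((Ψ i).coeff j : ℝ)| ≤ ∑ i', ∑ j, |((Ψ i').coeff j : ℝ)| :=
      Finset.single_le_sum (f := fun i' => ∑ j, |((Ψ i').coeff j : ℝ)|)
        (fun _ _ => Finset.sum_nonneg fun _ _ => abs_nonneg _) (Finset.mem_univ i)
    have hb : ∑ i', ∑ j, |((Ψ i').coeff j : ℝ)| ≤ affLinSize Ψ N :=
      le_add_of_nonneg_right (Finset.sum_nonneg fun _ _ => abs_nonneg _)
    linarith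
  have h2 : |((Ψ i).const : ℝ)| ≤ L * N := by
    have ha : |((Ψ i).const : ℝ) / N| ≤ ∑ i', |((Ψ i').const : ℝ) / N| :=
      Finset.single_le_sum (f := fun i' => |((Ψ i').const : ℝ) / N|) (fun _ _ => abs_nonneg _)
        (Finset.mem_univ i)
    have hb : ∑ i', |((Ψ i').const : ℝ) / N| ≤ affLinSize Ψ N :=
      le_add_of_nonneg_left (Finset.sum_nonneg fun _ _ => Finset.sum_nonneg fun _ _ =>
        abs_nonneg _)
    have : |((Ψ i).const : ℝ) / N| ≤ L := by linarith
    rwa [abs_div, abs_of_pos hN0, div_le_iff₀ hN0] at this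
  have h3 : |(∑ j, ((Ψ i).coeff j : ℝ) * x j)| ≤ L * N := by
    calc |∑ j, ((Ψ i).coeff j : ℝ) * x j| ≤ ∑ j, |((Ψ i).coeff j : ℝ) * x j| :=
          Finset.abs_sum_le_sum_abs _ _
      _ ≤ ∑ j, |((Ψ i).coeff j : ℝ)| * N := Finset.sum_le_sum fun j _ => by
          rw [abs_mul]
          exact mul_le_mul_of_nonneg_left (hxj j) (abs_nonneg _)
      _ = (∑ j, |((Ψ i).coeff j : ℝ)|) * N := (Finset.sum_mul _ _ _).symm
      _ ≤ L * N := mul_le_mul_of_nonneg_right h1 hN0.le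
  unfold AffLinForm.realEval
  calc |∑ j, ((Ψ i).coeff j : ℝ) * x j + ((Ψ i).const : ℝ)|
      ≤ |∑ j, ((Ψ i).coeff j : ℝ) * x j| + |((Ψ i).const : ℝ)| := abs_add_le _ _
    _ ≤ L * N + L * N := add_le_add h3 h2
    _ = 2 * L * N := by ring

/-- `[-N,N]^d ⊆ [-N',N']^d` for `N ≤ N'`. [folklore] -/
theorem realBox_mono (d : ℕ) {N N' : ℝ} (h : N ≤ N') : realBox d N ⊆ realBox d N' :=
  fun _ hx => ⟨fun j => le_trans (by simpa using neg_le_neg h) (hx.1 j), fun j => (hx.2 j).trans h⟩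

open Classical in
/-- For `K ⊆ [-N,N]^d` and `N ≤ N'`, the lattice points of `K` counted in the box
`[-N',N']^d` are those counted in `[-N,N]^d`. [folklore] -/
theorem filter_latticeBox_eq_of_subset {K : Set (Fin d → ℝ)} {N N' : ℕ} (hK : K ⊆ realBox d N)
    (hNN' : N ≤ N') :
    (latticeBox d N').filter (fun n => realPoint n ∈ K) =
      (latticeBox d N).filter (fun n => realPoint n ∈ K) := by
  ext n
  simp only [Finset.mem_filter, latticeBox, Fintype.mem_piFinset, Finset.mem_Icc]
  constructor
  · rintro ⟨-, hn⟩
    refine ⟨fun j => ⟨?_, ?_⟩, hn⟩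
    · have h1 : (-(N : ℝ)) ≤ (n j : ℝ) := (hK hn).1 j
      exact_mod_cast h1
    · have h2 : (n j : ℝ) ≤ N := (hK hn).2 j
      exact_mod_cast h2
  · rintro ⟨hn, hnK⟩
    refine ⟨fun j => ⟨?_, ?_⟩, hnK⟩
    · have := (hn j).1; omega
    · have := (hn j).2; omega

/-- A prime in `[CN, 2CN]` (Bertrand's postulate), for real `C > 0` and `CN ≥ 1`. [folklore] -/
theorem exists_prime_mem_Icc {C : ℝ} {N : ℕ} (hCN : 1 ≤ C * N) :
    ∃ p : ℕ, p.Prime ∧ C * N ≤ (p : ℝ) ∧ (p : ℝ) ≤ 2 * C * N := by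
  set n := ⌊C * N⌋₊ with hn
  have hn1 : 1 ≤ n := by rw [hn]; exact Nat.le_floor (by exact_mod_cast hCN)
  obtain ⟨p, hp, hnp, hp2⟩ := Nat.exists_prime_lt_and_le_two_mul n (by omega)
  refine ⟨p, hp, ?_, ?_⟩
  · have h1 : C * N < (n : ℝ) + 1 := by rw [hn]; exact Nat.lt_floor_add_one _
    have h2 : (n : ℝ) + 1 ≤ p := by exact_mod_cast hnp
    linarith
  · have h1 : (n : ℝ) ≤ C * N := by rw [hn]; exact Nat.floor_le (zero_le_one.trans hCN)
    have h2 : (p : ℝ) ≤ 2 * n := by exact_mod_cast hp2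
    linarith

/-! ### §7: Thm. 5.2 from Thm. 7.2, Prop. 6.4 and Prop. 7.1 -/

open Classical in
/-- **Proof of Theorem 5.2 assuming Theorem 7.2** (Green–Tao 2010, §7, "Proof of Main Theorem
assuming Theorem 7.2", as printed: "By previous reductions, it suffices to prove Theorem 5.2. …
By enlarging `N` by a multiplicative factor of `O(1)` if necessary we may assume that
`Ψ(K) ⊆ [N]^t`. Let `D = D_{s,t,d,L}` be the constant in Proposition 7.1, and set
`C := max(C₁, C₀(D))` … Applying Bertrand's postulate, we may select a prime `N'` such that
`CN ≤ N' ≤ 2CN`. Let `ν` be the `D`-pseudorandom measure given by Proposition 6.4. Then the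
functions `fᵢ(n) := c · (Λ'_{bᵢ,W} - 1)` will be pointwise dominated in magnitude by `ν` for
some suitably small constant `c = c_{s,t,d,L} > 0`. Applying Theorem 7.2 and Proposition 7.1,
we obtain the desired estimate after dividing out the factors of `c`."). Here: scale
`N₁ = 2L'N` (`L' = max(L,1)`, so `Ψ(K) ⊆ [1, N₁]^t`), `c = 1/M` with `M` the domination
constant of Prop. 6.4, `fᵢ = c (Λ'_{bᵢ,W} - 1) 1_{[⌈N₁^{3/5}⌉, ∞)}` (module docstring; on `K`,
`ψᵢ > N^{7/10} ≥ ⌈N₁^{3/5}⌉`), and the Gowers norm of `f₁` is at most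
`c ‖Λ'_{b₁,W} - 1‖_{U^{s+1}[N₁]} + O_s((log N₁)/M · N₁^{-2/5})^{1/2^{s+1}} ≤ δ`.
[cite: GreenTao2010, §7 (Proof of Main Theorem assuming Theorem 7.2), Prop. 6.4, Prop. 7.1,
Thm. 7.2] -/
theorem GreenTao2010_wTrickedProduct_of_gowersUniformity_of_props
    (h64 : GreenTao2010_pseudorandomDomination) (h71 : GreenTao2010_generalisedVonNeumann) :
    GreenTao2010_wTrickedProduct_of_gowersUniformity := by
  intro s hs hU d t L hd ht ε hε
  classical
  -- constants depending on `s, t, d, L`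
  obtain ⟨L', hL'⟩ : ∃ L' : ℕ, L' = max L 1 := ⟨_, rfl⟩
  have hL'1 : 1 ≤ L' := by rw [hL']; exact le_max_right _ _
  have hLL' : L ≤ L' := by rw [hL']; exact le_max_left _ _
  have hL'r1 : (1 : ℝ) ≤ L' := by exact_mod_cast hL'1
  obtain ⟨C₁, hC₁, D, hD, H71⟩ := h71 s t d L' hs ht hd hL'1
  obtain ⟨C₀, hC₀, H64⟩ := h64 (max D 2) t (le_max_right _ _) ht
  obtain ⟨C, hCdef⟩ : ∃ C : ℝ, C = max C₁ C₀ := ⟨_, rfl⟩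
  have hC₁C : C₁ ≤ C := by rw [hCdef]; exact le_max_left _ _
  have hC₀C : C₀ ≤ C := by rw [hCdef]; exact le_max_right _ _
  have hC0 : 0 < C := lt_of_lt_of_le hC₁ hC₁C
  obtain ⟨M, hM, A, H64'⟩ := H64 C hC₀C
  -- tolerances and thresholds
  have hε₁ : 0 < ε / (M ^ t * (2 * L') ^ d) := by positivity
  obtain ⟨δ, hδ, η, hη, N₁', H71'⟩ := H71 C hC₁C A _ hε₁
  obtain ⟨w₂, N₂, H64''⟩ := H64' η hη
  obtain ⟨w₃, N₃, hU'⟩ := hU (M * δ / 2) (by positivity)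
  obtain ⟨N₄, hN₄⟩ := logPow_cut_eventually
    (mul_nonneg (gowersPerturbConst_pos (s + 1)).le (by positivity) :
      (0 : ℝ) ≤ gowersPerturbConst (s + 1) * M⁻¹ ^ 2 ^ (s + 1))
    (by positivity : (0 : ℝ) < (δ / 2) ^ 2 ^ (s + 1)) (2 ^ (s + 1))
  obtain ⟨E, hE⟩ : ∃ E : ℕ, E = (2 * L' + 1) ^ 10 := ⟨_, rfl⟩
  obtain ⟨F, hF⟩ : ∃ F : ℕ, F = ⌈1 / C⌉₊ := ⟨_, rfl⟩
  refine ⟨w₂ + w₃, N₁' + N₂ + N₃ + N₄ + E + F + s + 4, ?_⟩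
  intro N hN w hw hwN Ψ hΨ hnf hL K hK hKN hpos b hb
  have hN₁'N : N₁' ≤ N := by omega
  have hN₂N : N₂ ≤ N := by omega
  have hN₃N : N₃ ≤ N := by omega
  have hN₄N : N₄ ≤ N := by omega
  have hEN : E ≤ N := by omega
  have hFN : F ≤ N := by omega
  have hsN : s + 2 ≤ N := by omega
  have hN2 : 2 ≤ N := by omega
  have hw₂ : w₂ ≤ w := by omega
  have hw₃ : w₃ ≤ w := by omega
  have hNr1 : (1 : ℝ) ≤ N := by exact_mod_cast (by omega : 1 ≤ N)
  have hNr0 : (0 : ℝ) < N := by linarith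
  -- the scale `N₁ = 2 L' N`
  obtain ⟨N₁, hN₁⟩ : ∃ N₁ : ℕ, N₁ = 2 * L' * N := ⟨_, rfl⟩
  have h2NN₁ : 2 * N ≤ N₁ := by
    rw [hN₁]; exact Nat.mul_le_mul_right N (Nat.mul_le_mul_left 2 hL'1)
  have hNN₁ : N ≤ N₁ := by omega
  have hN₁r : (N₁ : ℝ) = 2 * L' * N := by rw [hN₁]; push_cast; ring
  have hNN₁r : (N : ℝ) ≤ N₁ := by exact_mod_cast hNN₁
  have hN₁r1 : (1 : ℝ) ≤ N₁ := hNr1.trans hNN₁r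
  have hN₁r0 : (0 : ℝ) < N₁ := by linarith
  have hN₁k : 2 * (s + 1 + 1) ≤ N₁ := by omega
  have hwN₁ : (w : ℝ) ≤ Real.log (Real.log N₁) / 2 :=
    hwN.trans (by have := logLog_mono hN2 hNN₁; linarith)
  have hWN : primorial w ≤ N := by exact_mod_cast primorial_le_of_le_logLog hN2 hwN
  have hWN₁ : primorial w ≤ N₁ := hWN.trans hNN₁
  -- a prime `N' = p ∈ [C N₁, 2 C N₁]`
  have hCN₁ : 1 ≤ C * N₁ := by
    have hF1 : 1 / C ≤ F := by rw [hF]; exact Nat.le_ceil _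
    have hFN₁ : (F : ℝ) ≤ N₁ := by exact_mod_cast hFN.trans hNN₁
    calc (1 : ℝ) = C * (1 / C) := by field_simp
      _ ≤ C * N₁ := mul_le_mul_of_nonneg_left (hF1.trans hFN₁) hC0.le
  obtain ⟨p, hp, hCp, hp2⟩ := exists_prime_mem_Icc hCN₁
  haveI : NeZero p := ⟨hp.ne_zero⟩
  -- the pseudorandom majorant at scale `N₁`
  obtain ⟨ν, hν, hdom⟩ := H64'' N₁ (hN₂N.trans hNN₁) w hw₂ hwN₁ p hp hCp hp2 b hb
  -- the cut-off `m = ⌈N₁^{3/5}⌉ ≤ N^{7/10}`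
  set m : ℕ := ⌈(N₁ : ℝ) ^ ((3 : ℝ) / 5)⌉₊ with hm
  have hm7 : (m : ℝ) ≤ (N : ℝ) ^ ((7 : ℝ) / 10) := by
    have hm1 : (m : ℝ) < (N₁ : ℝ) ^ ((3 : ℝ) / 5) + 1 := Nat.ceil_lt_add_one (by positivity)
    have h35 : (N₁ : ℝ) ^ ((3 : ℝ) / 5) ≤ 2 * L' * (N : ℝ) ^ ((3 : ℝ) / 5) := by
      rw [hN₁r, Real.mul_rpow (by positivity) (by positivity)]
      exact mul_le_mul_of_nonneg_right (Real.rpow_le_self_of_one_le (by linarith) (by norm_num))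
        (by positivity)
    have h110 : 2 * (L' : ℝ) + 1 ≤ (N : ℝ) ^ ((1 : ℝ) / 10) := by
      have hE' : (((2 * L' + 1) ^ 10 : ℕ) : ℝ) ≤ N := by rw [← hE]; exact_mod_cast hEN
      push_cast at hE'
      calc 2 * (L' : ℝ) + 1 = ((2 * (L' : ℝ) + 1) ^ (10 : ℕ)) ^ ((10 : ℕ) : ℝ)⁻¹ :=
            (Real.pow_rpow_inv_natCast (by positivity) (by norm_num)).symm
        _ ≤ (N : ℝ) ^ ((10 : ℕ) : ℝ)⁻¹ := Real.rpow_le_rpow (by positivity) hE' (by positivity)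
        _ = (N : ℝ) ^ ((1 : ℝ) / 10) := by norm_num
    have hN35 : 1 ≤ (N : ℝ) ^ ((3 : ℝ) / 5) := Real.one_le_rpow hNr1 (by norm_num)
    calc (m : ℝ) ≤ 2 * L' * (N : ℝ) ^ ((3 : ℝ) / 5) + 1 := by linarith
      _ ≤ (2 * L' + 1) * (N : ℝ) ^ ((3 : ℝ) / 5) := by nlinarith
      _ ≤ (N : ℝ) ^ ((1 : ℝ) / 10) * (N : ℝ) ^ ((3 : ℝ) / 5) :=
          mul_le_mul_of_nonneg_right h110 (by positivity)
      _ = (N : ℝ) ^ ((7 : ℝ) / 10) := by rw [← Real.rpow_add hNr0]; norm_num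
  have hm35 : (N₁ : ℝ) ^ ((3 : ℝ) / 5) ≤ m := Nat.le_ceil _
  -- the functions `fᵢ = M⁻¹ (Λ'_{bᵢ,W} - 1) 1_{[m, ∞)}`
  set f : Fin t → ℤ → ℝ := fun i x =>
    if (m : ℤ) ≤ x then M⁻¹ * (vonMangoldtW (primorial w) (b i) x.toNat - 1) else 0 with hf
  have hfν : ∀ i, ∀ x : ℤ, 1 ≤ x → x ≤ N₁ → |f i x| ≤ ν (x : ZMod p) := by
    intro i x hx1 hxN
    by_cases hmx : (m : ℤ) ≤ x
    · have hx0 : 0 ≤ x := by omega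
      have hxnat : ((x.toNat : ℕ) : ℤ) = x := Int.toNat_of_nonneg hx0
      have h35 : (N₁ : ℝ) ^ ((3 : ℝ) / 5) ≤ (x.toNat : ℕ) := by
        have h2 : (m : ℝ) ≤ (x.toNat : ℕ) := by
          have : (m : ℤ) ≤ (x.toNat : ℤ) := by rw [hxnat]; exact hmx
          exact_mod_cast this
        linarith
      have hxN' : x.toNat ≤ N₁ := by omega
      have hd := hdom x.toNat h35 hxN'
      have hcast : ((x : ℤ) : ZMod p) = ((x.toNat : ℕ) : ZMod p) := by
        conv_lhs => rw [← hxnat]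
        exact Int.cast_natCast _
      have hf' : f i x = M⁻¹ * (vonMangoldtW (primorial w) (b i) x.toNat - 1) := by
        simp [hf, hmx]
      have hΛ0 := (vonMangoldtW_nonneg_le_log (primorial w) (b i) x.toNat).1
      have h1 : |vonMangoldtW (primorial w) (b i) x.toNat - 1| ≤
          1 + vonMangoldtW (primorial w) (b i) x.toNat := by
        rw [abs_le]; constructor <;> linarith
      have h2 : vonMangoldtW (primorial w) (b i) x.toNat ≤
          ∑ i', vonMangoldtW (primorial w) (b i') x.toNat :=
        Finset.single_le_sum (f := fun i' => vonMangoldtW (primorial w) (b i') x.toNat)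
          (fun i' _ => (vonMangoldtW_nonneg_le_log (primorial w) (b i') x.toNat).1)
          (Finset.mem_univ i)
      rw [hf', abs_mul, abs_of_pos (inv_pos.mpr hM), hcast]
      calc M⁻¹ * |vonMangoldtW (primorial w) (b i) x.toNat - 1|
          ≤ M⁻¹ * (1 + ∑ i', vonMangoldtW (primorial w) (b i') x.toNat) := by
            apply mul_le_mul_of_nonneg_left _ (inv_nonneg.mpr hM.le); linarith
        _ ≤ M⁻¹ * (M * ν ((x.toNat : ℕ) : ZMod p)) :=
            mul_le_mul_of_nonneg_left hd (inv_nonneg.mpr hM.le)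
        _ = ν _ := by field_simp
    · have : f i x = 0 := by simp [hf, hmx]
      rw [this, abs_zero]
      exact hν.1 _
  -- the Gowers norm of `f₁`: Thm. 7.2 at scale `N₁` plus the effect of the cut at `m`
  have hgowers : uniformityNorm (s + 1) N₁ (fun n => ((f ⟨0, ht⟩ n : ℝ) : ℂ)) ≤ δ := by
    set j₀ : Fin t := ⟨0, ht⟩ with hj₀
    set G : ℤ → ℂ := fun n => ((M⁻¹ : ℝ) : ℂ) * vonMangoldtWSubOne (primorial w) (b j₀) n
      with hG
    have hlogN₁ : 0 ≤ Real.log ((N₁ : ℝ) + 1) := Real.log_nonneg (by linarith)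
    set B₀ : ℝ := M⁻¹ * (1 + 2 * Real.log ((N₁ : ℝ) + 1)) with hB₀
    have hB₀0 : 0 ≤ B₀ := mul_nonneg (inv_nonneg.mpr hM.le) (by linarith)
    have hbW : b j₀ ≤ primorial w := (hb j₀).2.1
    have hGbd : ∀ x : ℤ, 1 ≤ x → x ≤ N₁ → ‖G x‖ ≤ B₀ := by
      intro x hx1 hxN
      simp only [hG, vonMangoldtWSubOne, norm_mul, Complex.norm_real, Real.norm_eq_abs,
        abs_of_pos (inv_pos.mpr hM)]
      exact mul_le_mul_of_nonneg_left (abs_vonMangoldtW_sub_one_le hWN₁ hbW hx1 hxN)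
        (inv_nonneg.mpr hM.le)
    have hFG' : ∀ x : ℤ, (m : ℤ) ≤ x → ((f j₀ x : ℝ) : ℂ) = G x := by
      intro x hmx
      have : f j₀ x = M⁻¹ * (vonMangoldtW (primorial w) (b j₀) x.toNat - 1) := by
        simp [hf, hmx]
      rw [this]
      simp only [hG, vonMangoldtWSubOne]
      push_cast
      ring
    have hFbd : ∀ x : ℤ, 1 ≤ x → x ≤ N₁ → ‖((f j₀ x : ℝ) : ℂ)‖ ≤ B₀ := by
      intro x hx1 hxN
      by_cases hmx : (m : ℤ) ≤ x
      · rw [hFG' x hmx]; exact hGbd x hx1 hxN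
      · have : f j₀ x = 0 := by simp [hf, hmx]
        rw [this]; simpa using hB₀0
    have hFG : ∀ x : ℤ, (m : ℤ) < x → x ≤ N₁ → ((f j₀ x : ℝ) : ℂ) = G x :=
      fun x hmx _ => hFG' x hmx.le
    have hpert := norm_uniformityAvg_sub_le (k := s + 1) hN₁k hB₀0 hFbd hGbd hFG
    have hΔ : gowersPerturbConst (s + 1) * B₀ ^ 2 ^ (s + 1) * m / N₁ ≤ (δ / 2) ^ 2 ^ (s + 1) := by
      have hm1 : (m : ℝ) ≤ (N₁ : ℝ) ^ ((3 : ℝ) / 5) + 1 :=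
        (Nat.ceil_lt_add_one (by positivity)).le
      have h4 := hN₄ N₁ (hN₄N.trans hNN₁)
      have ha0 : 0 ≤ gowersPerturbConst (s + 1) * M⁻¹ ^ 2 ^ (s + 1) *
          (1 + 2 * Real.log ((N₁ : ℝ) + 1)) ^ 2 ^ (s + 1) :=
        mul_nonneg (mul_nonneg (gowersPerturbConst_pos _).le (by positivity))
          (pow_nonneg (by linarith) _)
      calc gowersPerturbConst (s + 1) * B₀ ^ 2 ^ (s + 1) * m / N₁
          = gowersPerturbConst (s + 1) * M⁻¹ ^ 2 ^ (s + 1) *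
              (1 + 2 * Real.log ((N₁ : ℝ) + 1)) ^ 2 ^ (s + 1) * m / N₁ := by
            rw [hB₀, mul_pow]; ring
        _ ≤ gowersPerturbConst (s + 1) * M⁻¹ ^ 2 ^ (s + 1) *
              (1 + 2 * Real.log ((N₁ : ℝ) + 1)) ^ 2 ^ (s + 1) *
              ((N₁ : ℝ) ^ ((3 : ℝ) / 5) + 1) / N₁ :=
            div_le_div_of_nonneg_right (mul_le_mul_of_nonneg_left hm1 ha0) hN₁r0.le
        _ ≤ (δ / 2) ^ 2 ^ (s + 1) := h4
    have hnorm := uniformityNorm_le_add_rpow (by positivity) (hpert.trans hΔ)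
    have hGnorm : uniformityNorm (s + 1) N₁ G =
        M⁻¹ * uniformityNorm (s + 1) N₁ (vonMangoldtWSubOne (primorial w) (b j₀)) :=
      uniformityNorm_ofReal_mul (s + 1) N₁ (inv_nonneg.mpr hM.le) _
    have hU'' := hU' N₁ (hN₃N.trans hNN₁) w hw₃ hwN₁ (b j₀) (hb j₀).1 (hb j₀).2.1 (hb j₀).2.2
    have hroot : ((δ / 2) ^ 2 ^ (s + 1)) ^ ((2 : ℝ) ^ (s + 1))⁻¹ = δ / 2 := by
      have h2 : ((2 : ℝ) ^ (s + 1)) = ((2 ^ (s + 1) : ℕ) : ℝ) := by push_cast; ring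
      rw [h2, Real.pow_rpow_inv_natCast (by positivity) (by positivity)]
    calc uniformityNorm (s + 1) N₁ (fun n => ((f j₀ n : ℝ) : ℂ))
        ≤ uniformityNorm (s + 1) N₁ G + ((δ / 2) ^ 2 ^ (s + 1)) ^ ((2 : ℝ) ^ (s + 1))⁻¹ := hnorm
      _ = M⁻¹ * uniformityNorm (s + 1) N₁ (vonMangoldtWSubOne (primorial w) (b j₀)) + δ / 2 := by
          rw [hGnorm, hroot]
      _ ≤ M⁻¹ * (M * δ / 2) + δ / 2 := by gcongr
      _ = δ := by field_simp; ring
  -- Prop. 7.1 at scale `N₁`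
  have hLΨ : affLinSize Ψ N₁ ≤ L' :=
    (affLinSize_anti Ψ hNr0 hNN₁r).trans (hL.trans (by exact_mod_cast hLL'))
  have hKN₁ : K ⊆ realBox d N₁ := hKN.trans (realBox_mono d hNN₁r)
  have hvals : ∀ x ∈ K, ∀ i, 1 ≤ (Ψ i).realEval x ∧ (Ψ i).realEval x ≤ N₁ := by
    intro x hx i
    have hgt := hpos x hx i
    have h7 : 1 ≤ (N : ℝ) ^ ((7 : ℝ) / 10) := Real.one_le_rpow hNr1 (by norm_num)
    have hup := abs_realEval_le_of_affLinSize_le (L := (L : ℝ)) (by omega : 1 ≤ N) hL (hKN hx) i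
    have hLL'r : (L : ℝ) ≤ L' := by exact_mod_cast hLL'
    refine ⟨by linarith, ?_⟩
    calc (Ψ i).realEval x ≤ |(Ψ i).realEval x| := le_abs_self _
      _ ≤ 2 * L * N := hup
      _ ≤ 2 * L' * N :=
          mul_le_mul_of_nonneg_right (mul_le_mul_of_nonneg_left hLL'r (by norm_num)) hNr0.le
      _ = N₁ := hN₁r.symm
  have hmain := H71' N₁ (hN₁'N.trans hNN₁) p hp hCp hp2 ν (hν.mono (le_max_left D 2) le_rfl)
    f hfν Ψ hΨ hnf hLΨ K hK hKN₁ hvals ⟨⟨0, ht⟩, hgowers⟩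
  rw [filter_latticeBox_eq_of_subset hKN hNN₁] at hmain
  -- undo the normalisation `c = M⁻¹`
  have hsumeq : ∑ n ∈ (latticeBox d N).filter (fun n => realPoint n ∈ K),
      ∏ i, (vonMangoldtW (primorial w) (b i) ((Ψ i).eval n).toNat - 1) =
      M ^ t * ∑ n ∈ (latticeBox d N).filter (fun n => realPoint n ∈ K),
        ∏ i, f i ((Ψ i).eval n) := by
    rw [Finset.mul_sum]
    refine Finset.sum_congr rfl fun n hn => ?_
    have hnK : realPoint n ∈ K := (Finset.mem_filter.mp hn).2
    have hfi : ∀ i, f i ((Ψ i).eval n) =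
        M⁻¹ * (vonMangoldtW (primorial w) (b i) ((Ψ i).eval n).toNat - 1) := by
      intro i
      have hgt := hpos (realPoint n) hnK i
      rw [realEval_realPoint] at hgt
      have hlt : (m : ℝ) < ((Ψ i).eval n : ℝ) := lt_of_le_of_lt hm7 hgt
      have hmi : (m : ℤ) ≤ (Ψ i).eval n := by exact_mod_cast hlt.le
      simp [hf, hmi]
    rw [Finset.prod_congr rfl fun i _ => hfi i, Finset.prod_mul_distrib, Finset.prod_const,
      Finset.card_univ, Fintype.card_fin, ← mul_assoc, ← mul_pow, mul_inv_cancel₀ hM.ne',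
      one_pow, one_mul]
  rw [hsumeq, abs_mul, abs_of_pos (by positivity)]
  calc M ^ t * |∑ n ∈ (latticeBox d N).filter (fun n => realPoint n ∈ K), ∏ i, f i ((Ψ i).eval n)|
      ≤ M ^ t * (ε / (M ^ t * (2 * L') ^ d) * (N₁ : ℝ) ^ d) :=
        mul_le_mul_of_nonneg_left hmain (by positivity)
    _ = ε * (N : ℝ) ^ d := by
        rw [hN₁r]
        field_simp
        ring

/-! ### Assembly -/

/-- The transference `GreenTao2010_transference` from the printed reductions of §4 and §5 and
the two propositions of §§6–7 (Prop. 6.4, App. D; Prop. 7.1, App. C): with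
`GreenTao2010_main_of_mainNormalForm_holds` (`…MainReduction.lean`) and
`GreenTao2010_mainNormalForm_of_wTricked_holds` (`…WTrick.lean`) supplying `h₁`, `h₂`, the
transference rests on Props. 6.4 and 7.1 only. [cite: GreenTao2010, §§4–7] -/
theorem GreenTao2010_transference_of_props (h₁ : GreenTao2010_main_of_mainNormalForm)
    (h₂ : GreenTao2010_mainNormalForm_of_wTricked) (h64 : GreenTao2010_pseudorandomDomination)
    (h71 : GreenTao2010_generalisedVonNeumann) : GreenTao2010_transference :=
  GreenTao2010_transference_of_reductions h₁ h₂
    (GreenTao2010_wTrickedProduct_of_gowersUniformity_of_props h64 h71)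

/-- Assembly of the architecture down to the appendices: the reductions of §4, §5, Prop. 6.4,
Prop. 7.1 and the Gowers uniformity estimate Thm. 7.2 give the Green–Tao–Ziegler theorem.
[cite: GreenTao2010, Main Theorem] [cite: GreenTaoZiegler2012, Thm. 1.3 and the following
paragraph] -/
theorem GreenTaoZiegler2012_finiteComplexity_of_props (h₁ : GreenTao2010_main_of_mainNormalForm)
    (h₂ : GreenTao2010_mainNormalForm_of_wTricked) (h64 : GreenTao2010_pseudorandomDomination)
    (h71 : GreenTao2010_generalisedVonNeumann) (hU : GreenTao2010_gowersUniformity) :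
    GreenTaoZiegler2012_finiteComplexity :=
  GreenTaoZiegler2012_finiteComplexity_of_transference
    (GreenTao2010_transference_of_props h₁ h₂ h64 h71) hU

end Literature.NumberTheory.Sieve
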